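import Literature.NumberTheory.Automorphic.BrandtDataTransport
import Literature.NumberTheory.Automorphic.BrandtXi
import HarnessLib

/-!
# `ξ` depends only on the genus: `xiOfOrder (O_ℓ(I)) = xiOfOrder O` for an invertible right
# `O`-ideal `I` (Pollack–Weston's `ξ_f(N⁺, N⁻)` is independent of the connected Eichler order)

Topic `NumberTheory/Automorphic`; theorems only (no definition, no named fact, no instance).
`Brandt.xiOfOrder O N λ` (`BrandtXi.lean`) is `Brandt.xi` of the weights `Brandt.weight O` and
the common eigen-lattice of the Brandt matrices `Brandt.matrix O n`, `n` prime to `N`, inside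
`ℤ^{Cls O}`; `BrandtXi.lean` proved that it is invariant under *reindexing* the class set
(`Brandt.xi_eigenLattice_reindex`). `BrandtDataTransport.lean` proved that the Brandt data
(class set, weights, matrices) of a `ℤ`-order `O` of a division quaternion algebra over `ℚ` and of
the left order `O' = O_ℓ(I)` of any invertible right `O`-ideal `I` correspond along a bijection of
class sets (`BrandtData.ofOrder_transport`, in the vocabulary of `BrandtModule.lean`). Passing
through the dictionary of `BrandtModuleDictionary.lean` (class sets in bijection, weights equal,
matrices transposed) we obtain, for orders of a totally definite quaternion algebra over `ℚ`:

* `Brandt.exists_classSetEquiv_leftOrder` — a bijection `e : Cls O ≃ Cls O'` with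
  `weight O' (e c) = weight O c` and `matrix O' n (e c) (e d) = matrix O n c d`;
* `Brandt.xiOfOrder_leftOrder_eq` — **`xiOfOrder (O_ℓ(I)) N λ = xiOfOrder O N λ`** for every
  level `N` and eigenvalue system `λ`: the definite congruence number `ξ` is the same for all
  orders connected to `O` (its genus; Vignéras III §5 B, Eichler 1973 II §6), in particular it
  does not depend on the representative Eichler order chosen in `Brandt.XiSetup` within a genus.

## References

* M.-F. Vignéras, *Arithmétique des algèbres de quaternions*, LNM 800 (1980), Ch. III §5 B
  [VignerasLNM800].
* R. Pollack, T. Weston, Compos. Math. 147 (2011), §2.1 [PollackWeston2011].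
-/

noncomputable section

open scoped Pointwise

universe u

namespace Literature.NumberTheory.Automorphic

namespace Brandt

variable {D : Type u} [Ring D] [Algebra ℚ D] [IsQuaternionAlgebra ℚ D]

/-- **The Brandt data of `O` and `O_ℓ(I)` agree in the vocabulary of `BrandtXi.lean`**: for a
`ℤ`-order `O` of a totally definite quaternion algebra over `ℚ` and `I ∈ Brandt.rightIdeals O`
there is `e : Cls O ≃ Cls O_ℓ(I)` with `weight O_ℓ(I) (e c) = weight O c` and
`matrix O_ℓ(I) n (e c) (e d) = matrix O n c d`. [cite: VignerasLNM800, Ch. III §5 B] -/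
theorem exists_classSetEquiv_leftOrder (hdef : IsTotallyDefinite ℚ D) {O : Submodule ℤ D}
    (hO : IsOrder D O) {I : Submodule ℤ D} (hI : I ∈ rightIdeals O) :
    ∃ e : ClassSet O ≃ ClassSet (leftOrder I),
      (∀ c, weight (leftOrder I) (e c) = weight O c) ∧
      ∀ n c d, matrix (leftOrder I) n (e c) (e d) = matrix O n c d := by
  have hdiv : ∀ x : D, x ≠ 0 → IsUnit x := fun x hx => isUnit_of_isTotallyDefinite D hdef hx
  have hOZ : IsZOrder O := isZOrder_iff_isOrder.mpr hO
  have hIinv : IsInvertibleRightIdeal O I := isInvertibleRightIdeal_of_mem_rightIdeals hI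
  have hO'Z : IsZOrder (leftOrderOf I) := hIinv.isZOrder_leftOrderOf
  -- the dictionaries for `O` and for `O' = O_ℓ(I)` (`leftOrder I = leftOrderOf I` definitionally)
  have h : rightIdeals O = invertibleRightIdeals O :=
    rightIdeals_eq_invertibleRightIdeals_of_isTotallyDefinite hdef hOZ
  have h' : rightIdeals (leftOrderOf I) = invertibleRightIdeals (leftOrderOf I) :=
    rightIdeals_eq_invertibleRightIdeals_of_isTotallyDefinite hdef hO'Z
  -- the transport on `RightIdealClass`, conjugated by the two dictionaries
  obtain ⟨e₀, -, hw₀, hT₀⟩ := BrandtData.ofOrder_transport hdiv hOZ hIinv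
  refine ⟨(((ClassSet.equivRightIdealClass h).trans e₀).trans (ClassSet.equivRightIdealClass h').symm :
      ClassSet O ≃ ClassSet (leftOrderOf I)), fun c => ?_, fun n c d => ?_⟩
  · have h1 := BrandtData.ofOrder_w_equivRightIdealClass hO'Z h'
      ((ClassSet.equivRightIdealClass h').symm (e₀ (ClassSet.equivRightIdealClass h c)))
    rw [Equiv.apply_symm_apply, hw₀, BrandtData.ofOrder_w_equivRightIdealClass hOZ h] at h1
    exact h1.symm
  · have h1 := BrandtData.ofOrder_T_equivRightIdealClass hO'Z h' n
      ((ClassSet.equivRightIdealClass h').symm (e₀ (ClassSet.equivRightIdealClass h d)))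
      ((ClassSet.equivRightIdealClass h').symm (e₀ (ClassSet.equivRightIdealClass h c)))
    rw [Equiv.apply_symm_apply, Equiv.apply_symm_apply, hT₀,
      BrandtData.ofOrder_T_equivRightIdealClass hOZ h] at h1
    exact h1.symm

/-- **`ξ` depends only on the genus of the order**: `xiOfOrder (O_ℓ(I)) N λ = xiOfOrder O N λ`
for a `ℤ`-order `O` of a totally definite quaternion algebra over `ℚ` and `I ∈ Brandt.rightIdeals O`
(the Brandt data correspond along a bijection of class sets, and `xi` is invariant under
reindexing, `xi_eigenLattice_reindex`). [cite: PollackWeston2011, §2.1] -/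
theorem xiOfOrder_leftOrder_eq (hdef : IsTotallyDefinite ℚ D) {O : Submodule ℤ D}
    (hO : IsOrder D O) {I : Submodule ℤ D} (hI : I ∈ rightIdeals O) (N : ℕ) (lam : ℕ → ℤ) :
    xiOfOrder (leftOrder I) N lam = xiOfOrder O N lam := by
  classical
  haveI : IsAddTorsionFree D := isAddTorsionFree_of_charZero_module ℚ D
  haveI : Finite (ClassSet O) := finite_classSet ℚ hO
  have hO' : IsOrder D (leftOrder I) := isOrder_leftOrder hI.1
  haveI : Finite (ClassSet (leftOrder I)) := finite_classSet ℚ hO'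
  letI : Fintype (ClassSet O) := Fintype.ofFinite _
  letI : Fintype (ClassSet (leftOrder I)) := Fintype.ofFinite _
  obtain ⟨e, hw, hT⟩ := exists_classSetEquiv_leftOrder hdef hO hI
  have hmat : (matrix (leftOrder I)) = fun n => Matrix.reindex e e (matrix O n) := by
    funext n
    ext a b
    rw [Matrix.reindex_apply, Matrix.submatrix_apply, ← hT n (e.symm a) (e.symm b),
      Equiv.apply_symm_apply, Equiv.apply_symm_apply]
  have hwt : weight (leftOrder I) = weight O ∘ e.symm := by
    funext a
    rw [Function.comp_apply, ← hw (e.symm a), Equiv.apply_symm_apply]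
  rw [xiOfOrder_eq, xiOfOrder_eq, hmat, hwt, xi_eigenLattice_reindex]

end Brandt

end Literature.NumberTheory.Automorphic

end
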